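import Summits.CriticalPhenomena.PercolationContinuityZ3.Theorems.Transplant.SkelPhiCorridorKGPrism
import Summits.CriticalPhenomena.PercolationContinuityZ3.Theorems.Transplant.SkelPhiCorridorKGYPrism
import Summits.CriticalPhenomena.PercolationContinuityZ3.Theorems.Transplant.SkelPhiCorridorKGValues
import Summits.CriticalPhenomena.PercolationContinuityZ3.Theorems.Transplant.SkelPhiCorridorKGYValues
import HarnessLib

/-!
# N2 (frames-only node `SamePDropOfSkeletonFrm₁`, OPEN), (C) column, (c)-numerics: **THE K-G CORRIDOR'S PRISM AND ARRIVAL BOX AS TWO FRAME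
# BOXES IN CLOSED FORM** — `Skelφ.kgZ₀ / kgZ₁` + `mem_kgCorrSched_prism_box` (the prism lies in `[−Z₀, (N+1)n + Z₀] × [−Z₁, Z₁]`, any slots),
# `KGRows.kgLastLo / kgLastHi` + `KGRows.mem_Icc_of_mem_last` (the arrival core is the box `[(N+1)n + X − (n+ρ−1), (N+1)n + X] × [⌈(Ctr2 − Hw2)/2⌉,
# ⌊(Ctr2 + Hw2)/2⌋]` at the slot values of SkelPhiCorridorKGValues); second axis `kgZY₀ / kgZY₁`, `mem_kgCorrSchedY_prism_box`, `KGYRows.mem_Icc_of_mem_lastY`.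

These two boxes are what the fine reading `fine_sub_ctr_mem_rd` (SkelPhiCorridorKGPrism §1) turns into level / transverse margins about `cenS (tgt e)` for the
Γ rows `hΩball / hreg / hlastM` of `reachOblAtHNF_of_kgCorrE` (SkelPhiCorridorKGRoomsQ, next file), and the prism box gives the one radius row of
`coreWindow_nonempty_of_qsteps` (`D₀ + (kq+3)·((N+1)n + Z₀ + Z₁) ≤ R`).  Over `mem_kgCorrSched(Y)_prism_cases` (KGPrism/KGYPrism) and `kgVals_last /
kgYVals_last` (KGValues/KGYValues).
builds on p205010 (kernel theorem, internal audit signed; external expert review pending) — nothing in this file uses p205010; nothing here is a claim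
about the open node `SamePDropOfSkeletonFrm₁`.
Lane `prim-bschramm`, seat `prim-bschramm-p5` (gen 16; (C) lineage); helper file (`--supports stmt-CriticalPhenomena-4575 --as helper`).
[cite: KozmaNitzan2024, §4 Lemma 11 (p. 22: the prism Ω), Lemma 12 (pp. 23–25: the target box)]
-/

namespace Summit.CriticalPhenomena.PercolationContinuityZ3.Theorems.Transplant

namespace Skelφ

open Literature.Probability.Percolation Literature.Probability.LatticeModels SimpleGraph
open ChainPlanar ChainPara

/-! ## §1 First axis: the prism in one box -/

section BoxX

variable {n ℓ : ℕ} {hs v : ℤ} {R' ρ q W N m₁ Wm₂ Wp₂ m₂ : ℕ}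
  (hP₁ : ParkOK (kgPark₁ n ℓ hs v R' ρ q W N m₁)) (hP₂ : ParkOK (kgPark₂ n ℓ hs v R' ρ q W N m₁ Wm₂ Wp₂ m₂))
  (hsplit : (Wm₂ : ℤ) + Wp₂ = (kgPark₁ n ℓ hs v R' ρ q W N m₁).aHi (m₁ + 1) - ParkPrm.aLo (kgPark₁ n ℓ hs v R' ρ q W N m₁) (m₁ + 1))

/-- **Along half-extent of the prism box** (about `0` below, about `(N+1)n` above): `Z₀ := q + (N+1)R′ + (m₁+1)(R′+ρ+|v|) + (m₂+1)(R′+ρ) + R′ + 2n`. [this work] -/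
def kgZ₀ (n : ℕ) (v : ℤ) (R' ρ q N m₁ m₂ : ℕ) : ℤ :=
  (q : ℤ) + (N + 1) * R' + ((m₁ : ℤ) + 1) * (R' + ρ + |v|) + ((m₂ : ℤ) + 1) * (R' + ρ) + R' + 2 * n

/-- **Across half-extent of the prism box**: `Z₁ := A₁ + P + Wm₂ + Wp₂ + (m₁+m₂+2)(R′+ρ) + R′ + L` (`A₁ = kgA₁`, `P = ⌊nℓ/U⌋+1`, `L = ⌊3nℓ/U⌋+1`). [this work] -/
def kgZ₁ (n ℓ : ℕ) (hs : ℤ) (R' ρ W N m₁ Wm₂ Wp₂ m₂ : ℕ) : ℤ :=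
  ((kgA₁ n ℓ hs R' W N : ℕ) : ℤ) + ((n * ℓ / shearUnit n hs + 1 : ℕ) : ℤ) + Wm₂ + Wp₂ + ((m₁ : ℤ) + m₂ + 2) * (R' + ρ) + R' +
    ((3 * (n * ℓ) / shearUnit n hs + 1 : ℕ) : ℤ)

include hP₁ hP₂ hsplit in
/-- **THE PRISM OF THE K-G CORRIDOR LIES IN ONE FRAME BOX** `[−Z₀, (N+1)n + Z₀] × [−Z₁, Z₁]` (any admissible slots). [this work] -/
theorem mem_kgCorrSched_prism_box {y : Site 2} (hy : y ∈ (kgCorrSched hP₁ hP₂ hsplit).prism) :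
    -kgZ₀ n v R' ρ q N m₁ m₂ ≤ y 0 ∧ y 0 ≤ ((N : ℤ) + 1) * n + kgZ₀ n v R' ρ q N m₁ m₂ ∧
      -kgZ₁ n ℓ hs R' ρ W N m₁ Wm₂ Wp₂ m₂ ≤ y 1 ∧ y 1 ≤ kgZ₁ n ℓ hs R' ρ W N m₁ Wm₂ Wp₂ m₂ := by
  -- nonnegative atoms and products
  have hρ0 : (0 : ℤ) ≤ ρ := by positivity
  have hR0 : (0 : ℤ) ≤ R' := by positivity
  have hv0 : (0 : ℤ) ≤ |v| := abs_nonneg v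
  have hn0 : (0 : ℤ) ≤ n := by positivity
  have hq0 : (0 : ℤ) ≤ q := by positivity
  have hW0 : (0 : ℤ) ≤ W := by positivity
  have hWm : (0 : ℤ) ≤ Wm₂ := by positivity
  have hWp : (0 : ℤ) ≤ Wp₂ := by positivity
  have hP0 : (0 : ℤ) ≤ (n : ℤ) * ℓ / (shearUnit n hs : ℕ) + 1 := by
    have : (0 : ℤ) ≤ (n : ℤ) * ℓ / (shearUnit n hs : ℕ) := Int.ediv_nonneg (by positivity) (by positivity)
    linarith
  have hL0 : (0 : ℤ) ≤ 3 * ((n : ℤ) * ℓ) / (shearUnit n hs : ℕ) + 1 := by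
    have : (0 : ℤ) ≤ 3 * ((n : ℤ) * ℓ) / (shearUnit n hs : ℕ) := Int.ediv_nonneg (by positivity) (by positivity)
    linarith
  have hNR : (0 : ℤ) ≤ ((N : ℤ) + 1) * R' := by positivity
  have hNn : (0 : ℤ) ≤ ((N : ℤ) + 1) * n := by positivity
  have p1 : (0 : ℤ) ≤ ((m₁ : ℤ) + 1) * (R' + ρ + |v|) := by positivity
  have p1' : (0 : ℤ) ≤ (m₁ : ℤ) * (R' + ρ + |v|) := by positivity
  have p2 : (0 : ℤ) ≤ ((m₂ : ℤ) + 1) * (R' + ρ) := by positivity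
  have p2' : (0 : ℤ) ≤ (m₂ : ℤ) * (R' + ρ) := by positivity
  have p3 : (0 : ℤ) ≤ (m₁ : ℤ) * (R' + ρ) := by positivity
  have p4 : (0 : ℤ) ≤ ((m₁ : ℤ) + m₂ + 2) * (R' + ρ) := by positivity
  have e4 : ((m₁ : ℤ) + m₂ + 2) * (R' + ρ) = (m₁ : ℤ) * (R' + ρ) + (m₂ : ℤ) * (R' + ρ) + 2 * (R' + ρ) := by ring
  have e1 : ((m₁ : ℤ) + 1) * (R' + ρ + |v|) = (m₁ : ℤ) * (R' + ρ + |v|) + (R' + ρ + |v|) := by ring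
  have e2 : ((m₂ : ℤ) + 1) * (R' + ρ) = (m₂ : ℤ) * (R' + ρ) + (R' + ρ) := by ring
  have eN : ((N : ℤ) + 1) * n = (N : ℤ) * n + n := by ring
  have hA₁ : ((kgA₁ n ℓ hs R' W N : ℕ) : ℤ) = (n : ℤ) * ℓ / (shearUnit n hs : ℕ) + 1 + W + ((N : ℤ) + 1) * R' := by
    unfold kgA₁; push_cast; ring
  unfold kgZ₀ kgZ₁
  push_cast
  rw [hA₁]
  rcases mem_kgCorrSched_prism_cases hP₁ hP₂ hsplit hy with ⟨h1, h2, h3⟩ | ⟨h1, h2, h3⟩ | ⟨h1, h2, h3, h4⟩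
  · obtain ⟨h3a, h3b⟩ := abs_le.1 h3
    push_cast at h1 h2 h3a h3b
    refine ⟨by linarith, by linarith, by linarith, by linarith⟩
  · obtain ⟨h3a, h3b⟩ := abs_le.1 h3
    push_cast at h1 h2 h3a h3b
    have hmin : -((n : ℤ) * ℓ / (shearUnit n hs : ℕ) + 1 + W + ((N : ℤ) + 1) * R') - ((n : ℤ) * ℓ / (shearUnit n hs : ℕ) + 1) ≤
        min (-((n : ℤ) * ℓ / (shearUnit n hs : ℕ) + 1 + W + ((N : ℤ) + 1) * R'))
          ((n : ℤ) * ℓ / (shearUnit n hs : ℕ) + 1 + W + ((N : ℤ) + 1) * R' + 1 - ((n : ℤ) * ℓ / (shearUnit n hs : ℕ) + 1)) :=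
      le_min (by linarith) (by linarith)
    rw [hA₁] at h1 h2
    refine ⟨by linarith, by linarith, by linarith, by linarith⟩
  · push_cast at h1 h2 h3 h4
    have hmin : -((q : ℤ) + ((N : ℤ) + 1) * R' + ((m₁ : ℤ) + 1) * (R' + ρ + |v|)) - n ≤
        min (-((q : ℤ) + ((N : ℤ) + 1) * R') - ((m₁ : ℤ) + 1) * (R' + ρ + |v|))
          ((q : ℤ) + ((N : ℤ) + 1) * R' + ((m₁ : ℤ) + 1) * (R' + ρ + |v|) + 1 - n) :=
      le_min (by linarith) (by linarith)
    rw [hA₁] at h3 h4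
    refine ⟨by linarith, by linarith, by linarith, by linarith⟩

/-- `|z₀| + |z₁| ≤ (N+1)n + Z₀ + Z₁` on the prism (the radius row of `coreWindow_nonempty_of_qsteps` becomes one inequality). [this work] -/
theorem natAbs_le_of_mem_kgCorrSched_prism {y : Site 2} (hy : y ∈ (kgCorrSched hP₁ hP₂ hsplit).prism) :
    ((y 0).natAbs : ℤ) + (y 1).natAbs ≤ ((N : ℤ) + 1) * n + kgZ₀ n v R' ρ q N m₁ m₂ + kgZ₁ n ℓ hs R' ρ W N m₁ Wm₂ Wp₂ m₂ := by
  obtain ⟨h1, h2, h3, h4⟩ := mem_kgCorrSched_prism_box hP₁ hP₂ hsplit hy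
  have hNn : (0 : ℤ) ≤ ((N : ℤ) + 1) * n := by positivity
  have hZ : 0 ≤ kgZ₀ n v R' ρ q N m₁ m₂ := by unfold kgZ₀; positivity
  rw [Int.natCast_natAbs, Int.natCast_natAbs]
  have ha := abs_le.2 (And.intro (show -(((N : ℤ) + 1) * n + kgZ₀ n v R' ρ q N m₁ m₂) ≤ y 0 by linarith) h2)
  have hb := abs_le.2 (And.intro h3 h4)
  linarith

end BoxX

/-! ## §2 First axis: the arrival core as one box, at the values -/

section LastX

variable {n ℓ : ℕ} {hs v : ℤ} {R' ρ q W : ℕ}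

/-- Lower corner of the arrival box: `((N+1)n + X − (n+ρ−1), ⌈(Ctr2 − Hw2)/2⌉)`. [this work] -/
def KGRows.kgLastLo (_H : KGRows n ℓ hs v R' ρ q W) (N : ℕ) : Site 2 :=
  ![((N : ℤ) + 1) * n + kgX n ℓ hs v R' ρ q W N - ((n : ℤ) + ρ - 1), (kgCtr2 n ℓ hs R' ρ W N - kgHw2 n ℓ hs v R' ρ q W N + 1) / 2]

/-- Upper corner of the arrival box: `((N+1)n + X, ⌊(Ctr2 + Hw2)/2⌋)`. [this work] -/
def KGRows.kgLastHi (_H : KGRows n ℓ hs v R' ρ q W) (N : ℕ) : Site 2 :=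
  ![((N : ℤ) + 1) * n + kgX n ℓ hs v R' ρ q W N, (kgCtr2 n ℓ hs R' ρ W N + kgHw2 n ℓ hs v R' ρ q W N) / 2]

/-- **THE ARRIVAL CORE IS A FRAME BOX** `[kgLastLo, kgLastHi]` at the values. [cite: KozmaNitzan2024, §4 Lemma 12 (pp. 23–25: the target box)] -/
theorem KGRows.mem_Icc_of_mem_last (H : KGRows n ℓ hs v R' ρ q W) (N : ℕ) {y : Site 2}
    (hy : y ∈ (kgCorrSched (H.kgVals_ok₁ N) (H.kgVals_ok₂ N) (H.kgVals_split N)).core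
      ((kgCorrSched (H.kgVals_ok₁ N) (H.kgVals_ok₂ N) (H.kgVals_split N)).N + 1)) :
    y ∈ Finset.Icc (H.kgLastLo N) (H.kgLastHi N) := by
  obtain ⟨⟨h1, h2⟩, h3, h4⟩ := H.kgVals_last N hy
  rw [Finset.mem_Icc, Pi.le_def, Pi.le_def, Fin.forall_fin_two, Fin.forall_fin_two]
  simp only [KGRows.kgLastLo, KGRows.kgLastHi, Matrix.cons_val_zero, Matrix.cons_val_one]
  refine ⟨⟨by linarith, ?_⟩, by linarith, ?_⟩
  · -- `⌈(L)/2⌉ ≤ y₁` from `L ≤ 2 y₁`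
    have := Int.ediv_le_ediv (by norm_num : (0 : ℤ) < 2) (show kgCtr2 n ℓ hs R' ρ W N - kgHw2 n ℓ hs v R' ρ q W N + 1 ≤ 2 * y 1 + 1 by linarith)
    rw [show (2 * y 1 + 1) / 2 = y 1 by omega] at this
    exact this
  · -- `y₁ ≤ ⌊(U)/2⌋` from `2 y₁ ≤ U`
    have := Int.ediv_le_ediv (by norm_num : (0 : ℤ) < 2) h4
    rw [show 2 * y 1 / 2 = y 1 by omega] at this
    exact this

end LastX

/-! ## §3 Second axis: the prism in one box; the arrival core as one box -/

section BoxY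

variable {n ℓ : ℕ} {hs v : ℤ} {R' ρ q W N m₁ Wm₂ Wp₂ m₂ : ℕ} (hn : 1 ≤ n) (hv : |v| ≤ n) (hlay : (n + hs.natAbs : ℕ) ≤ (n : ℤ) * ℓ + 1)
  (hP₁ : ParkOK (kgPark₁Y n ℓ hs v R' ρ q W N m₁)) (hP₂ : ParkOK (kgPark₂Y n ℓ hs v R' ρ q W N m₁ Wm₂ Wp₂ m₂))
  (hsplit : (Wm₂ : ℤ) + Wp₂ = (kgPark₁Y n ℓ hs v R' ρ q W N m₁).aHi (m₁ + 1) - ParkPrm.aLo (kgPark₁Y n ℓ hs v R' ρ q W N m₁) (m₁ + 1))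

/-- **Across (`x′`) half-extent of the second-axis prism box**: `ZY₀ := (N+2)|v| + 2n + W + (N+1)R′ + Wm₂ + Wp₂ + (m₁+m₂+2)(R′+ρ+|v|) + R′`. [this work] -/
def kgZY₀ (n : ℕ) (v : ℤ) (R' ρ W N m₁ Wm₂ Wp₂ m₂ : ℕ) : ℤ :=
  ((N : ℤ) + 2) * |v| + 2 * n + W + (N + 1) * R' + Wm₂ + Wp₂ + ((m₁ : ℤ) + m₂ + 2) * (R' + ρ + |v|) + R'

/-- **Along (rows) half-extent of the second-axis prism box** (about `0` below, about `(N+1)·P` above): `ZY₁ := q + (N+1)R′ + (N+1)dS + (m₁+m₂+2)(R′+ρ) +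
R′ + L + P`. [this work] -/
def kgZY₁ (n ℓ : ℕ) (hs : ℤ) (R' ρ q N m₁ m₂ : ℕ) : ℤ :=
  (q : ℤ) + (N + 1) * R' + (N + 1) * (dS n ℓ hs : ℕ) + ((m₁ : ℤ) + m₂ + 2) * (R' + ρ) + R' + ((3 * (n * ℓ) / shearUnit n hs + 1 : ℕ) : ℤ) +
    ((n * ℓ / shearUnit n hs + 1 : ℕ) : ℤ)

include hn hv hlay hP₁ hP₂ hsplit in
/-- **THE SECOND-AXIS PRISM LIES IN ONE FRAME BOX** `[−ZY₀, ZY₀] × [−ZY₁, (N+1)·P + ZY₁]`. [this work] -/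
theorem mem_kgCorrSchedY_prism_box {y : Site 2} (hy : y ∈ (kgCorrSchedY hn hv hlay hP₁ hP₂ hsplit).prism) :
    -kgZY₀ n v R' ρ W N m₁ Wm₂ Wp₂ m₂ ≤ y 0 ∧ y 0 ≤ kgZY₀ n v R' ρ W N m₁ Wm₂ Wp₂ m₂ ∧
      -kgZY₁ n ℓ hs R' ρ q N m₁ m₂ ≤ y 1 ∧ y 1 ≤ ((N : ℤ) + 1) * ((n * ℓ / shearUnit n hs + 1 : ℕ) : ℤ) + kgZY₁ n ℓ hs R' ρ q N m₁ m₂ := by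
  have hρ0 : (0 : ℤ) ≤ ρ := by positivity
  have hR0 : (0 : ℤ) ≤ R' := by positivity
  have hv0 : (0 : ℤ) ≤ |v| := abs_nonneg v
  have hn0 : (0 : ℤ) ≤ n := by positivity
  have hq0 : (0 : ℤ) ≤ q := by positivity
  have hN0 : (0 : ℤ) ≤ N := by positivity
  have hW0 : (0 : ℤ) ≤ W := by positivity
  have hWm : (0 : ℤ) ≤ Wm₂ := by positivity
  have hWp : (0 : ℤ) ≤ Wp₂ := by positivity
  have hdS0 : (0 : ℤ) ≤ ((dS n ℓ hs : ℕ) : ℤ) := by positivity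
  have hP0 : (0 : ℤ) ≤ (n : ℤ) * ℓ / (shearUnit n hs : ℕ) + 1 := by
    have : (0 : ℤ) ≤ (n : ℤ) * ℓ / (shearUnit n hs : ℕ) := Int.ediv_nonneg (by positivity) (by positivity)
    linarith
  have hL0 : (0 : ℤ) ≤ 3 * ((n : ℤ) * ℓ) / (shearUnit n hs : ℕ) + 1 := by
    have : (0 : ℤ) ≤ 3 * ((n : ℤ) * ℓ) / (shearUnit n hs : ℕ) := Int.ediv_nonneg (by positivity) (by positivity)
    linarith
  have hvb := abs_le.1 hv
  have hvn : (((n : ℤ) + v).toNat : ℤ) = n + v := Int.toNat_of_nonneg (by omega)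
  have hvp : (((n : ℤ) - v).toNat : ℤ) = n - v := Int.toNat_of_nonneg (by omega)
  have hAm : ((kgA₁Ym n v R' W N : ℕ) : ℤ) = (n : ℤ) + v + W + ((N : ℤ) + 1) * R' := by unfold kgA₁Ym; push_cast; rw [hvn]
  have hAp : ((kgA₁Yp n v R' W N : ℕ) : ℤ) = (n : ℤ) - v + W + ((N : ℤ) + 1) * R' := by unfold kgA₁Yp; push_cast; rw [hvp]
  have hvle : v ≤ |v| := le_abs_self v
  have hvge : -|v| ≤ v := neg_abs_le v
  have hNR : (0 : ℤ) ≤ ((N : ℤ) + 1) * R' := by positivity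
  have hNv : (0 : ℤ) ≤ ((N : ℤ) + 1) * |v| := by positivity
  have hNd : (0 : ℤ) ≤ ((N : ℤ) + 1) * ((dS n ℓ hs : ℕ) : ℤ) := by positivity
  have hvv : ((N : ℤ) + 1) * v ≤ ((N : ℤ) + 1) * |v| := mul_le_mul_of_nonneg_left hvle (by positivity)
  have hvv' : ((N : ℤ) + 1) * (-|v|) ≤ ((N : ℤ) + 1) * v := mul_le_mul_of_nonneg_left hvge (by positivity)
  have hNv' : (N : ℤ) * |v| ≤ ((N : ℤ) + 1) * |v| := by
    have e : ((N : ℤ) + 1) * |v| = (N : ℤ) * |v| + |v| := by ring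
    linarith
  have p1 : (0 : ℤ) ≤ (m₁ : ℤ) * (R' + ρ) := by positivity
  have p2 : (0 : ℤ) ≤ (m₂ : ℤ) * (R' + ρ) := by positivity
  have p3 : (0 : ℤ) ≤ (m₂ : ℤ) * (R' + ρ + |v|) := by positivity
  have p4 : (0 : ℤ) ≤ (m₁ : ℤ) * (R' + ρ + |v|) := by positivity
  have e4 : ((m₁ : ℤ) + m₂ + 2) * (R' + ρ + |v|) = (m₁ : ℤ) * (R' + ρ + |v|) + (m₂ : ℤ) * (R' + ρ + |v|) + 2 * (R' + ρ + |v|) := by ring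
  have e4' : ((m₁ : ℤ) + m₂ + 2) * (R' + ρ) = (m₁ : ℤ) * (R' + ρ) + (m₂ : ℤ) * (R' + ρ) + 2 * (R' + ρ) := by ring
  have e5 : (m₁ : ℤ) * (R' + ρ + |v|) = (m₁ : ℤ) * (R' + ρ) + (m₁ : ℤ) * |v| := by ring
  have e6 : (m₂ : ℤ) * (R' + ρ + |v|) = (m₂ : ℤ) * (R' + ρ) + (m₂ : ℤ) * |v| := by ring
  have p5 : (0 : ℤ) ≤ (m₁ : ℤ) * |v| := by positivity
  have p6 : (0 : ℤ) ≤ (m₂ : ℤ) * |v| := by positivity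
  have e1 : ((m₁ : ℤ) + 1) * (R' + ρ) = (m₁ : ℤ) * (R' + ρ) + (R' + ρ) := by ring
  have eNv : ((N : ℤ) + 1) * (-|v|) = -(((N : ℤ) + 1) * |v|) := by ring
  have eN2 : ((N : ℤ) + 2) * |v| = ((N : ℤ) + 1) * |v| + |v| := by ring
  -- `0 ≤ sL ≤ P`
  have hU : (0 : ℤ) < (shearUnit n hs : ℕ) := shearUnit_pos hn hs
  have hsL0 : 0 ≤ ((n : ℤ) * ℓ - (shearUnit n hs : ℕ) + 1) / (shearUnit n hs : ℕ) :=
    Int.ediv_nonneg (by unfold shearUnit; push_cast at hlay ⊢; omega) hU.le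
  have hsLP : ((n : ℤ) * ℓ - (shearUnit n hs : ℕ) + 1) / (shearUnit n hs : ℕ) ≤ (n : ℤ) * ℓ / (shearUnit n hs : ℕ) + 1 := by
    have h1 : ((n : ℤ) * ℓ - (shearUnit n hs : ℕ) + 1) / (shearUnit n hs : ℕ) ≤ (n : ℤ) * ℓ / (shearUnit n hs : ℕ) :=
      Int.ediv_le_ediv hU (by linarith)
    linarith
  have hNs : ((N : ℤ) + 1) * (((n : ℤ) * ℓ - (shearUnit n hs : ℕ) + 1) / (shearUnit n hs : ℕ)) ≤
      ((N : ℤ) + 1) * ((n : ℤ) * ℓ / (shearUnit n hs : ℕ) + 1) := mul_le_mul_of_nonneg_left hsLP (by positivity)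
  have hNs0 : 0 ≤ ((N : ℤ) + 1) * (((n : ℤ) * ℓ - (shearUnit n hs : ℕ) + 1) / (shearUnit n hs : ℕ)) := by positivity
  have hNP : (N : ℤ) * ((n : ℤ) * ℓ / (shearUnit n hs : ℕ) + 1) ≤ ((N : ℤ) + 1) * ((n : ℤ) * ℓ / (shearUnit n hs : ℕ) + 1) := by
    have e : ((N : ℤ) + 1) * ((n : ℤ) * ℓ / (shearUnit n hs : ℕ) + 1) = (N : ℤ) * ((n : ℤ) * ℓ / (shearUnit n hs : ℕ) + 1) + ((n : ℤ) * ℓ / (shearUnit n hs : ℕ) + 1) := by ring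
    linarith
  unfold kgZY₀ kgZY₁
  push_cast
  rcases mem_kgCorrSchedY_prism_cases hn hv hlay hP₁ hP₂ hsplit hy with ⟨h1, h2, h3, h4⟩ | ⟨h1, h2, h3, h4⟩ | ⟨h1, h2, h3, h4⟩
  · push_cast at h1 h2 h3 h4
    rw [hvn] at h3
    rw [hvp] at h4
    refine ⟨by linarith, by linarith, by linarith, by linarith⟩
  · rw [hAm, hAp] at h1
    rw [hAp] at h2
    push_cast at h1 h2 h3 h4
    have hmin : -((n : ℤ) + v + W + ((N : ℤ) + 1) * R') ≤
        min (-((n : ℤ) + v + W + ((N : ℤ) + 1) * R')) ((n : ℤ) - v + W + ((N : ℤ) + 1) * R' + 1 - n) :=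
      le_min le_rfl (by linarith)
    refine ⟨by linarith, by linarith, by linarith, by linarith⟩
  · rw [hAp] at h3 h4
    push_cast at h1 h2 h3 h4
    have p7 : (0 : ℤ) ≤ (q : ℤ) + ((N : ℤ) + 1) * R' + ((N : ℤ) + 1) * ((dS n ℓ hs : ℕ) : ℤ) + ((m₁ : ℤ) + 1) * (R' + ρ) := by positivity
    have hmin : -((q : ℤ) + ((N : ℤ) + 1) * R' + ((N : ℤ) + 1) * ((dS n ℓ hs : ℕ) : ℤ) + ((m₁ : ℤ) + 1) * (R' + ρ)) -
          ((n : ℤ) * ℓ / (shearUnit n hs : ℕ) + 1) ≤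
        min (-((q : ℤ) + ((N : ℤ) + 1) * R') - ((m₁ : ℤ) + 1) * (R' + ρ))
          ((q : ℤ) + ((N : ℤ) + 1) * R' + ((N : ℤ) + 1) * ((dS n ℓ hs : ℕ) : ℤ) + ((m₁ : ℤ) + 1) * (R' + ρ) + 1 -
            ((n : ℤ) * ℓ / (shearUnit n hs : ℕ) + 1)) :=
      le_min (by linarith) (by linarith)
    refine ⟨by linarith, by linarith, by linarith, by linarith⟩

/-- `|z₀| + |z₁| ≤ (N+1)·P + ZY₀ + ZY₁` on the second-axis prism. [this work] -/
theorem natAbs_le_of_mem_kgCorrSchedY_prism {y : Site 2} (hy : y ∈ (kgCorrSchedY hn hv hlay hP₁ hP₂ hsplit).prism) :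
    ((y 0).natAbs : ℤ) + (y 1).natAbs ≤
      ((N : ℤ) + 1) * ((n * ℓ / shearUnit n hs + 1 : ℕ) : ℤ) + kgZY₀ n v R' ρ W N m₁ Wm₂ Wp₂ m₂ + kgZY₁ n ℓ hs R' ρ q N m₁ m₂ := by
  obtain ⟨h1, h2, h3, h4⟩ := mem_kgCorrSchedY_prism_box hn hv hlay hP₁ hP₂ hsplit hy
  have hNP : (0 : ℤ) ≤ ((N : ℤ) + 1) * ((n * ℓ / shearUnit n hs + 1 : ℕ) : ℤ) := by positivity
  have hZ : 0 ≤ kgZY₁ n ℓ hs R' ρ q N m₁ m₂ + ((N : ℤ) + 1) * ((n * ℓ / shearUnit n hs + 1 : ℕ) : ℤ) := by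
    have : 0 ≤ kgZY₁ n ℓ hs R' ρ q N m₁ m₂ := by unfold kgZY₁; positivity
    linarith
  rw [Int.natCast_natAbs, Int.natCast_natAbs]
  have ha := abs_le.2 (And.intro h1 h2)
  have hb := abs_le.2 (And.intro (show -(((N : ℤ) + 1) * ((n * ℓ / shearUnit n hs + 1 : ℕ) : ℤ) + kgZY₁ n ℓ hs R' ρ q N m₁ m₂) ≤ y 1 by linarith) h4)
  linarith

end BoxY

section LastY

variable {n ℓ : ℕ} {hs v : ℤ} {R' ρ q W : ℕ}

/-- Lower corner of the second-axis arrival box: `(⌈(Ctr2Y − Hw2Y)/2⌉, (N+1)·sL + XY − (P+ρ−1))`. [this work] -/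
def KGYRows.kgLastLoY (_H : KGYRows n ℓ hs v R' ρ q W) (N : ℕ) : Site 2 :=
  ![(kgCtr2Y n v R' ρ W N - kgHw2Y n ℓ hs v R' ρ q W N + 1) / 2,
    ((N : ℤ) + 1) * kgSLY n ℓ hs + kgXY n ℓ hs v R' ρ q W N - ((n : ℤ) * ℓ / (shearUnit n hs : ℕ) + 1 + ρ - 1)]

/-- Upper corner of the second-axis arrival box: `(⌊(Ctr2Y + Hw2Y)/2⌋, (N+1)·sL + XY)`. [this work] -/
def KGYRows.kgLastHiY (_H : KGYRows n ℓ hs v R' ρ q W) (N : ℕ) : Site 2 :=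
  ![(kgCtr2Y n v R' ρ W N + kgHw2Y n ℓ hs v R' ρ q W N) / 2, ((N : ℤ) + 1) * kgSLY n ℓ hs + kgXY n ℓ hs v R' ρ q W N]

/-- **THE SECOND-AXIS ARRIVAL CORE IS A FRAME BOX** `[kgLastLoY, kgLastHiY]` at the values. [cite: KozmaNitzan2024, §4 Lemma 12 (pp. 23–25)] -/
theorem KGYRows.mem_Icc_of_mem_lastY (H : KGYRows n ℓ hs v R' ρ q W) (N : ℕ) {y : Site 2}
    (hy : y ∈ (kgCorrSchedY H.hn H.hv H.hlay (H.kgYVals_ok₁ N) (H.kgYVals_ok₂ N) (H.kgYVals_split N)).core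
      ((kgCorrSchedY H.hn H.hv H.hlay (H.kgYVals_ok₁ N) (H.kgYVals_ok₂ N) (H.kgYVals_split N)).N + 1)) :
    y ∈ Finset.Icc (H.kgLastLoY N) (H.kgLastHiY N) := by
  obtain ⟨⟨h1, h2⟩, h3, h4⟩ := H.kgYVals_last N hy
  rw [Finset.mem_Icc, Pi.le_def, Pi.le_def, Fin.forall_fin_two, Fin.forall_fin_two]
  simp only [KGYRows.kgLastLoY, KGYRows.kgLastHiY, Matrix.cons_val_zero, Matrix.cons_val_one]
  refine ⟨⟨?_, by linarith⟩, ?_, by linarith⟩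
  · have := Int.ediv_le_ediv (by norm_num : (0 : ℤ) < 2) (show kgCtr2Y n v R' ρ W N - kgHw2Y n ℓ hs v R' ρ q W N + 1 ≤ 2 * y 0 + 1 by linarith)
    rw [show (2 * y 0 + 1) / 2 = y 0 by omega] at this
    exact this
  · have := Int.ediv_le_ediv (by norm_num : (0 : ℤ) < 2) h4
    rw [show 2 * y 0 / 2 = y 0 by omega] at this
    exact this

end LastY

end Skelφ

end Summit.CriticalPhenomena.PercolationContinuityZ3.Theorems.Transplant
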